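import Summits.QuantumFields.YangMills.Theorems.BalabanUVNodesPortS1JacobianHolo

/-!
# NODE O port PT-A — `det Ad^ℂ(g) = (det g)³`: the adjoint action of `M₂(ℂ)` on the `su2Gen`-span in complex coordinates (`Ad^ℂ(g)_{ia} = su2CoordC(g·su2Gen a·adj g)_i`) has determinant `(det g)³`,
# hence `1` on `SL(2,ℂ)` (row (d) of `stub_LZjac`: the holomorphic Jacobian factor `log det A₁^ℂ(c)` is invariant when the block is conjugated by complex adjoint matrices) and on `SU(2)` — where it
# sharpens ✓p812159's `|det Ad(g)| = 1` to `det Ad(g) = 1` and gives EXACT gauge invariance `det A₁(c)(V^u) = det A₁(c)(V)` of DEF-1's real Jacobian determinants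

Cell `ym-nodeO-ideate`, porter seat `ymgap-nodeO-port-PTA-1` (gen 5); `--supports stmt-QuantumFields-27930` (helper; row (d) brick of the registered stub `stub_LZjac`, PORT-PLAN-v5 §4).  [I] = [Balaban1987RG1].
CONSUMED BY NAME: ✓p812392 (`su2CoordC`), ✓p812449 (`su2CoordC_of_mem_lieSU`), ✓p812159 (`b0Block_gaugeAct`), ✓p812054 (`coe_mul_star_self_SU`, `star_mul_coe_self_SU`), `B15AveragingHolomorphic.adjugate_coe_eq_star`,
`T4AdjointCovarianceUnitary.conj_mem_lieSU`, Mathlib's `Matrix.det_fin_three ∕ det_fin_two ∕ adjugate_fin_two`, `RingHom.map_det`.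
* `det_adMatC` (a polynomial identity, by `ring`), `det_adMatC_of_det_eq_one`, ★ `det_adMat_eq_one` (SU(2), real coordinates), ★★ `det_b0Block_gaugeAct` (exact invariance at small backgrounds).

HONEST FRAMING.  Finite-dimensional algebra; NOTHING of Bałaban asserted; `stub_LZjac` OPEN; `stub_LZdet` BLOCKED-ON P0 (α)+(β); `stub_FE` XXL; 27930 OPEN · no claim; K0⁷∕K-Ax OPEN; NODE O 0∕1; COUNT 8∕28 ·
K 1∕4 UNMOVED; finite `𝕋⁴_{L^K}` at fixed ε — NOT continuum ∕ OS ∕ Clay; **the Yang–Mills mass gap is NOT proved by any of this.**  No `sorry`, no `def`, no `instance`, no `notation`; standard axioms.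
-/

noncomputable section

open scoped BigOperators Matrix.Norms.L2Operator Topology

namespace Summit.QuantumFields.YangMills.Theorems.BalabanUVNodesPortS1

open Summit.QuantumFields.YangMills.Theorems.K0RecordFormatNames
open Literature.MathematicalPhysics.QuantumFieldTheory.Balaban1983to89
open Literature.MathematicalPhysics.QuantumFieldTheory.Balaban1983to89.Node00
open Literature.MathematicalPhysics.QuantumFieldTheory.Balaban1983to89.T4Continuum (T4Family)
open Literature.MathematicalPhysics.QuantumFieldTheory.Balaban1983to89.BlockAveraging (Small)
open Literature.MathematicalPhysics.QuantumFieldTheory.Balaban1983to89.ExpMeanLog (expMeanLogSU)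
open Literature.MathematicalPhysics.QuantumFieldTheory.Balaban1983to89.T4AdjointCovarianceUnitary (lieSU conj_mem_lieSU)
open _root_.Matrix

/-- ★ **`det Ad^ℂ(g) = (det g)³`** for every `g ∈ M₂(ℂ)`, `Ad^ℂ(g)_{ia} := su2CoordC(g·su2Gen a·adj g)_i` (a polynomial identity in the four entries of `g`). [folklore] -/
theorem det_adMatC (g : MatA 2) :
    (Matrix.of fun i a : Fin 3 => su2CoordC (g * su2Gen a * g.adjugate) i).det = g.det ^ 3 := by
  rw [Matrix.det_fin_three, Matrix.adjugate_fin_two, Matrix.det_fin_two]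
  simp [su2CoordC, su2Gen, Matrix.mul_apply, Fin.sum_univ_two]
  ring_nf
  simp only [Complex.I_pow_four]
  ring

/-- **On `SL(2,ℂ)` the complex adjoint matrix has determinant `1`** (the invariance of `log det A₁^ℂ(c)` under conjugation of the block by adjoint matrices — row (d) of `stub_LZjac`).
[cite: Balaban1987RG1, (1.19) p.263, (1.10) p.262] -/
theorem det_adMatC_of_det_eq_one {g : MatA 2} (hg : g.det = 1) :
    (Matrix.of fun i a : Fin 3 => su2CoordC (g * su2Gen a * g.adjugate) i).det = 1 := by
  rw [det_adMatC, hg, one_pow]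

/-- ★ **On `SU(2)` the REAL adjoint matrix `Ad(g)_{ja} = su2Coord(g·su2Gen a·g*)_j` has determinant `1`** (sharpening ✓p812159's `|det| = 1`: on 𝔰𝔲(2) the complex coordinates are the real ones and
`adj g = g*`). [folklore] -/
theorem det_adMat_eq_one (g : SU 2) :
    (Matrix.of fun j a : Fin 3 => su2Coord ((g : MatA 2) * su2Gen a * star (g : MatA 2)) j).det = 1 := by
  have hmem : ∀ a : Fin 3, (g : MatA 2) * su2Gen a * star (g : MatA 2) ∈ lieSU (Fin 2) := fun a =>
    conj_mem_lieSU (sum_smul_su2Gen_mem_lieSU (Pi.single a 1) |> fun h => by simpa using h : su2Gen a ∈ lieSU (Fin 2)) ⟨(g : MatA 2), (Matrix.mem_specialUnitaryGroup_iff.mp g.2).1⟩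
  have hmap : (Matrix.of fun j a : Fin 3 => su2Coord ((g : MatA 2) * su2Gen a * star (g : MatA 2)) j).map ((↑) : ℝ → ℂ) =
      Matrix.of fun i a : Fin 3 => su2CoordC ((g : MatA 2) * su2Gen a * (g : MatA 2).adjugate) i := by
    ext j a
    rw [Matrix.map_apply, Matrix.of_apply, Matrix.of_apply, B15AveragingHolomorphic.adjugate_coe_eq_star, su2CoordC_of_mem_lieSU (hmem a)]
  have hdetC := det_adMatC_of_det_eq_one (Matrix.mem_specialUnitaryGroup_iff.mp g.2).2
  rw [← hmap] at hdetC
  have h := RingHom.map_det Complex.ofRealHom (Matrix.of fun j a : Fin 3 => su2Coord ((g : MatA 2) * su2Gen a * star (g : MatA 2)) j)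
  have hmap' : Complex.ofRealHom.mapMatrix (Matrix.of fun j a : Fin 3 => su2Coord ((g : MatA 2) * su2Gen a * star (g : MatA 2)) j) =
      (Matrix.of fun j a : Fin 3 => su2Coord ((g : MatA 2) * su2Gen a * star (g : MatA 2)) j).map ((↑) : ℝ → ℂ) := rfl
  rw [hmap', hdetC, Complex.ofRealHom_eq_coe] at h
  exact_mod_cast h

variable (F : T4Family)

open Classical in
/-- ★★ **EXACT GAUGE INVARIANCE OF THE JACOBIAN DETERMINANTS**: `det A₁(c)(V^u) = det A₁(c)(V)` at every background in the (0.4) guard (✓p812159's block law with BOTH adjoint determinants `= 1`).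
[cite: Balaban1987RG1, (2.16) p.269, (1.19) p.263, p.268] -/
theorem det_b0Block_gaugeAct (k K : ℕ) (hk : k + 1 ≤ (F.P K).m + (F.P K).K) (u : GaugeTransf (F.P K) k (SU 2)) (Vk : GaugeField (F.P K) k (SU 2))
    (hs : ∀ c : PBond (F.P K) (k + 1), Small expMeanLogSU Vk c) (c : PBond (F.P K) (k + 1)) :
    (Matrix.of fun j j' : Fin 3 => recordLQtB0 F k K (GaugeField.gaugeAct u Vk) (c, j) (c, j')).det =
      (Matrix.of fun j j' : Fin 3 => recordLQtB0 F k K Vk (c, j) (c, j')).det := by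
  rw [b0Block_gaugeAct F k K hk u Vk hs c, Matrix.det_mul, Matrix.det_mul, det_adMat_eq_one]
  have h2 : (Matrix.of fun j j' : Fin 3 => su2Coord (star ((u (recordB0 F k K c).src : SU 2) : MatA 2) * su2Gen j' *
      ((u (recordB0 F k K c).src : SU 2) : MatA 2)) j).det = 1 := by
    have h := det_adMat_eq_one (u (recordB0 F k K c).src)⁻¹
    have hinv : (((u (recordB0 F k K c).src)⁻¹ : SU 2) : MatA 2) = star ((u (recordB0 F k K c).src : SU 2) : MatA 2) := rfl
    simpa only [hinv, star_star] using h
  rw [h2, one_mul, mul_one]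

end Summit.QuantumFields.YangMills.Theorems.BalabanUVNodesPortS1

end
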